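import Literature.MathematicalPhysics.QuantumLattice.SectorPropagatorDecay
import Literature.Analysis.Calculus.LineRestrictionIteratedDeriv
import Literature.Probability.LatticeModels.TorusMomentaInRotatedBox
import HarnessLib

/-!
# The single-scale sector symbol in the original coordinates: smoothness, support and `h`-uniform line-derivative bounds

Topic `MathematicalPhysics/QuantumLattice`; the form of the `h`-uniform symbol estimates of Benfatto–Giuliani–Mastropietro
2006, Lemma 2.2, that the LATTICE (finite `β`, finite `L`) propagator bounds consume
(`Probability/LatticeModels/SampledSymbolTorusDecay.lean`: derivative bounds of the continuum symbol along real lines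
`s ↦ q + s w` in the original frequency–momentum coordinates).  The tree proves the estimates in RESCALED coordinates
(`SectorSymbolMasterSmooth.exists_norm_iteratedFDeriv_rescaledSectorSymbol_le`: `‖Dᴺ R‖ ≤ 4ⁿ B_N` for the rescaled
symbol `R = rescaledSectorSymbol`, uniformly in the scale `h = -n` and the sector, `γ = 4`); here they are pulled
back through the anisotropic chart `A = sectorChart` (`k = q_F + A t`):

* `sectorSymbol_eq_sectorSymbolE_toLp`, `toLp_add_smul` — the symbol on `ℝ × ℝ²` is the symbol on `ℝ³` composed with
  the (linear) coordinate embedding;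
* `fermiFrame_complete` — the rows of the frame `(n, τ)` are orthonormal too; **`sectorChart_symm_apply`** — the
  inverse chart `A⁻¹(k₀, k⃗) = (4ⁿ k₀, 4ⁿ⟨n, k⃗⟩, 2ⁿ⟨τ, k⃗⟩)`, and `norm_sectorChart_symm_toLp_le` — `‖A⁻¹ w‖ ≤
  4ⁿ|w₀| + 4ⁿ|⟨n, w⃗⟩| + 2ⁿ|⟨τ, w⃗⟩|`: a unit step along the normal costs `γ^{-h}`, along the tangent only `γ^{-h/2}`;
* `contDiff_sectorSymbol` — the symbol is smooth on `ℝ × ℝ²`;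
* **`exists_norm_iteratedDeriv_sectorSymbol_line_le`** — for every `N` there is `B ≥ 0` with
  `‖∂ₛᴺ sectorSymbol(q + s w)‖ ≤ 4ⁿ B (4ⁿ|w₀| + 4ⁿ|⟨n(θ_{n,ω}), w⃗⟩| + 2ⁿ|⟨τ(θ_{n,ω}), w⃗⟩|)ᴺ` for ALL `n`, all
  sectors `ω < 2^{n+1}`, all `q, w, s` (`lineRestriction_comp_affine` + `norm_iteratedDeriv_lineRestriction_le_of_le`);
* **`sectorSymbol_support`** — if `sectorSymbol(k₀, k⃗) ≠ 0` then `|k₀| ≤ e₀4^{-n}`, `|⟨k⃗ - p_F, n⟩| ≤ C₁4^{-n}`,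
  `|⟨k⃗ - p_F, τ⟩| ≤ C₂2^{-n}` and `|kⱼ| ≤ π/2` (frequency window, rotated box, central zone copy).

Everything is proved for the fillings `-4 < μ < -2-√2` of the tree's chain (`TODO(general form)`: the whole hole-doped
band via `bandFermiRadius`); no definitions, no named facts.

## Sources

G. Benfatto, A. Giuliani, V. Mastropietro, Ann. Henri Poincaré 7 (2006) 809–898, §2.5 Lemma 2.2 and (2.46)–(2.52)
(`BenfattoGiulianiMastropietro2006`); G. Benfatto, A. Giuliani, V. Mastropietro, Ann. Henri Poincaré 4 (2003) 137–193,
§7.2 (`BenfattoGiulianiMastropietro2003`).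
-/

noncomputable section

open Set Literature.Analysis.Calculus Literature.Probability.LatticeModels
open scoped Real

namespace Literature.MathematicalPhysics.QuantumLattice

/-! ### The coordinate embedding `ℝ × ℝ² → ℝ³` -/

/-- The symbol on `ℝ × ℝ²` is the symbol on `ℝ³` at the embedded point `(k₀, k₁, k₂)`. [folklore] -/
theorem sectorSymbol_eq_sectorSymbolE_toLp (e₀ μ : ℝ) (n : ℕ) (ω : ℤ) (p : ℝ × (Fin 2 → ℝ)) :
    sectorSymbol e₀ μ n ω p = sectorSymbolE e₀ μ n ω (WithLp.toLp 2 ![p.1, p.2 0, p.2 1]) := by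
  rw [sectorSymbolE]
  dsimp only
  rw [splitMomentum_apply]
  congr 1
  ext <;> simp
  rename_i j
  fin_cases j <;> rfl

/-- The embedding is linear along lines: `E(q + s w) = E q + s • E w`. [folklore] -/
theorem toLp_add_smul (q w : ℝ × (Fin 2 → ℝ)) (s : ℝ) :
    (WithLp.toLp 2 ![(q + s • w).1, (q + s • w).2 0, (q + s • w).2 1] : MomSpace) =
      WithLp.toLp 2 ![q.1, q.2 0, q.2 1] + s • WithLp.toLp 2 ![w.1, w.2 0, w.2 1] := by
  ext i
  fin_cases i <;> simp [smul_eq_mul]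

/-! ### The inverse chart -/

section Chart

variable {μ : ℝ} (hμ₁ : -4 < μ) (hμ₂ : μ < -2 - Real.sqrt 2)
include hμ₁ hμ₂

/-- **The rows of the Fermi frame are orthonormal**: `n₀² + τ₀² = 1`, `n₁² + τ₁² = 1`, `n₀n₁ + τ₀τ₁ = 0`. [folklore] -/
theorem fermiFrame_complete (θ₀ : ℝ) :
    fermiNormal μ θ₀ 0 ^ 2 + fermiTangent μ θ₀ 0 ^ 2 = 1 ∧ fermiNormal μ θ₀ 1 ^ 2 + fermiTangent μ θ₀ 1 ^ 2 = 1 ∧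
      fermiNormal μ θ₀ 0 * fermiNormal μ θ₀ 1 + fermiTangent μ θ₀ 0 * fermiTangent μ θ₀ 1 = 0 := by
  have hn := fermiNormal_normSq hμ₁ hμ₂ θ₀
  have hτ := fermiTangent_normSq hμ₁ hμ₂ θ₀
  have hnτ : fermiNormal μ θ₀ 0 * fermiTangent μ θ₀ 0 + fermiNormal μ θ₀ 1 * fermiTangent μ θ₀ 1 = 0 := by
    have := fermiTangent_dot_fermiNormal μ θ₀; linarith [this]
  have h10 := frame_sq_add_sq_eq hn hτ hnτ ![1, 0]
  have h01 := frame_sq_add_sq_eq hn hτ hnτ ![0, 1]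
  have h11 := frame_sq_add_sq_eq hn hτ hnτ ![1, 1]
  simp only [Matrix.cons_val_zero, Matrix.cons_val_one, one_mul, zero_mul, add_zero,
    zero_add, one_pow, zero_pow two_ne_zero] at h10 h01 h11
  refine ⟨h10, h01, ?_⟩
  nlinarith [h10, h01, h11]

/-- **The inverse anisotropic chart**: `A⁻¹(k₀, k⃗) = (4ⁿ k₀, 4ⁿ ⟨n, k⃗⟩, 2ⁿ ⟨τ, k⃗⟩)`. [cite: BenfattoGiulianiMastropietro2006, §2.5 Lemma 2.2] -/
theorem sectorChart_symm_apply (θ₀ : ℝ) (n : ℕ) (k : MomSpace) :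
    (sectorChart hμ₁ hμ₂ θ₀ n).symm k = WithLp.toLp 2
      ![(4 : ℝ) ^ n * k 0,
        (4 : ℝ) ^ n * (fermiNormal μ θ₀ 0 * k 1 + fermiNormal μ θ₀ 1 * k 2),
        (2 : ℝ) ^ n * (fermiTangent μ θ₀ 0 * k 1 + fermiTangent μ θ₀ 1 * k 2)] := by
  obtain ⟨h0, h1, h01⟩ := fermiFrame_complete hμ₁ hμ₂ θ₀
  rw [ContinuousLinearEquiv.symm_apply_eq, sectorChart_apply]
  have h4 : (4 : ℝ) ^ (-(n : ℤ)) * (4 : ℝ) ^ n = 1 := by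
    rw [zpow_neg, zpow_natCast, inv_mul_cancel₀ (by positivity)]
  have h2 : (2 : ℝ) ^ (-(n : ℤ)) * (2 : ℝ) ^ n = 1 := by
    rw [zpow_neg, zpow_natCast, inv_mul_cancel₀ (by positivity)]
  ext i
  fin_cases i
  · simp only [Matrix.cons_val_zero]
    show k 0 = (4 : ℝ) ^ (-(n : ℤ)) * ((4 : ℝ) ^ n * k 0)
    rw [← mul_assoc, h4, one_mul]
  · simp only [Matrix.cons_val_one, Matrix.cons_val_zero]
    show k 1 = (4 : ℝ) ^ (-(n : ℤ)) * fermiNormal μ θ₀ 0 * ((4 : ℝ) ^ n * (fermiNormal μ θ₀ 0 * k 1 + fermiNormal μ θ₀ 1 * k 2)) +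
      (2 : ℝ) ^ (-(n : ℤ)) * fermiTangent μ θ₀ 0 * ((2 : ℝ) ^ n * (fermiTangent μ θ₀ 0 * k 1 + fermiTangent μ θ₀ 1 * k 2))
    linear_combination (-(k 1)) * h0 - k 2 * h01 - (fermiNormal μ θ₀ 0 * (fermiNormal μ θ₀ 0 * k 1 + fermiNormal μ θ₀ 1 * k 2)) * h4
      - (fermiTangent μ θ₀ 0 * (fermiTangent μ θ₀ 0 * k 1 + fermiTangent μ θ₀ 1 * k 2)) * h2
  · simp only [Matrix.cons_val_two, Matrix.tail_cons, Matrix.head_cons, Matrix.cons_val_one,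
      Matrix.cons_val_zero]
    show k 2 = (4 : ℝ) ^ (-(n : ℤ)) * fermiNormal μ θ₀ 1 * ((4 : ℝ) ^ n * (fermiNormal μ θ₀ 0 * k 1 + fermiNormal μ θ₀ 1 * k 2)) +
      (2 : ℝ) ^ (-(n : ℤ)) * fermiTangent μ θ₀ 1 * ((2 : ℝ) ^ n * (fermiTangent μ θ₀ 0 * k 1 + fermiTangent μ θ₀ 1 * k 2))
    linear_combination (-(k 2)) * h1 - k 1 * h01 - (fermiNormal μ θ₀ 1 * (fermiNormal μ θ₀ 0 * k 1 + fermiNormal μ θ₀ 1 * k 2)) * h4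
      - (fermiTangent μ θ₀ 1 * (fermiTangent μ θ₀ 0 * k 1 + fermiTangent μ θ₀ 1 * k 2)) * h2

omit hμ₁ hμ₂ in
/-- `√(a² + b² + c²) ≤ |a| + |b| + |c|`. [folklore] -/
theorem sqrt_sq_add_sq_add_sq_le (a b c : ℝ) : Real.sqrt (a ^ 2 + b ^ 2 + c ^ 2) ≤ |a| + |b| + |c| := by
  rw [Real.sqrt_le_left (by positivity)]
  nlinarith [abs_nonneg a, abs_nonneg b, abs_nonneg c, sq_abs a, sq_abs b, sq_abs c]

/-- **The dual scales**: `‖A⁻¹(w₀, w⃗)‖ ≤ 4ⁿ|w₀| + 4ⁿ|⟨n, w⃗⟩| + 2ⁿ|⟨τ, w⃗⟩|`. [cite: BenfattoGiulianiMastropietro2006, §2.5 Lemma 2.2 (2.52)] -/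
theorem norm_sectorChart_symm_toLp_le (θ₀ : ℝ) (n : ℕ) (w : ℝ × (Fin 2 → ℝ)) :
    ‖(sectorChart hμ₁ hμ₂ θ₀ n).symm (WithLp.toLp 2 ![w.1, w.2 0, w.2 1])‖ ≤
      (4 : ℝ) ^ n * |w.1| + (4 : ℝ) ^ n * |fermiNormal μ θ₀ 0 * w.2 0 + fermiNormal μ θ₀ 1 * w.2 1| +
        (2 : ℝ) ^ n * |fermiTangent μ θ₀ 0 * w.2 0 + fermiTangent μ θ₀ 1 * w.2 1| := by
  rw [sectorChart_symm_apply hμ₁ hμ₂, EuclideanSpace.norm_eq, Fin.sum_univ_three]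
  simp only [Matrix.cons_val_zero, Matrix.cons_val_one, Matrix.head_cons, Matrix.cons_val_two,
    Matrix.tail_cons, Real.norm_eq_abs, sq_abs]
  refine (sqrt_sq_add_sq_add_sq_le _ _ _).trans (le_of_eq ?_)
  rw [abs_mul, abs_mul, abs_mul, abs_of_pos (by positivity : (0 : ℝ) < 4 ^ n),
    abs_of_pos (by positivity : (0 : ℝ) < 2 ^ n)]

end Chart

/-! ### Smoothness and the line-derivative bounds -/

section Lines

variable {μ : ℝ} (hμ₁ : -4 < μ) (hμ₂ : μ < -2 - Real.sqrt 2)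
include hμ₁ hμ₂

omit hμ₁ hμ₂ in
/-- The coordinate embedding is smooth. [folklore] -/
theorem contDiff_toLp_embed {m : WithTop ℕ∞} :
    ContDiff ℝ m fun p : ℝ × (Fin 2 → ℝ) => (WithLp.toLp 2 ![p.1, p.2 0, p.2 1] : MomSpace) := by
  have h1 : ContDiff ℝ m fun p : ℝ × (Fin 2 → ℝ) => (![p.1, p.2 0, p.2 1] : Fin 3 → ℝ) := by
    refine contDiff_pi.2 fun i => ?_
    fin_cases i
    · show ContDiff ℝ m fun p : ℝ × (Fin 2 → ℝ) => p.1
      exact contDiff_fst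
    · show ContDiff ℝ m fun p : ℝ × (Fin 2 → ℝ) => p.2 0
      exact (contDiff_apply ℝ ℝ (0 : Fin 2)).comp contDiff_snd
    · show ContDiff ℝ m fun p : ℝ × (Fin 2 → ℝ) => p.2 1
      exact (contDiff_apply ℝ ℝ (1 : Fin 2)).comp contDiff_snd
  exact (PiLp.contDiff_toLp (p := 2) (𝕜 := ℝ)).comp h1

omit hμ₁ hμ₂ in
/-- The line through `q` along `w`, embedded, through the chart: the restriction of the symbol to a line is the
restriction of the RESCALED symbol to the line through `A⁻¹(E q - q_F)` along `A⁻¹(E w)`. [folklore] -/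
theorem sectorSymbol_line_eq (hμ₁ : -4 < μ) (hμ₂ : μ < -2 - Real.sqrt 2) (e₀ : ℝ) (n : ℕ) (ω : ℤ)
    (q w : ℝ × (Fin 2 → ℝ)) :
    (fun s : ℝ => sectorSymbol e₀ μ n ω (q + s • w)) = fun s : ℝ =>
      rescaledSectorSymbol hμ₁ hμ₂ e₀ n ω
        ((sectorChart hμ₁ hμ₂ (((ω : ℝ) + 1 / 2) * sectorWidth n) n).symm
            ((WithLp.toLp 2 ![q.1, q.2 0, q.2 1] : MomSpace) + -fermiBasePoint μ (((ω : ℝ) + 1 / 2) * sectorWidth n)) +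
          s • (sectorChart hμ₁ hμ₂ (((ω : ℝ) + 1 / 2) * sectorWidth n) n).symm (WithLp.toLp 2 ![w.1, w.2 0, w.2 1])) := by
  have h := lineRestriction_comp_affine (rescaledSectorSymbol hμ₁ hμ₂ e₀ n ω)
    ((sectorChart hμ₁ hμ₂ (((ω : ℝ) + 1 / 2) * sectorWidth n) n).symm : MomSpace →L[ℝ] MomSpace)
    (-fermiBasePoint μ (((ω : ℝ) + 1 / 2) * sectorWidth n)) (WithLp.toLp 2 ![q.1, q.2 0, q.2 1])
    (WithLp.toLp 2 ![w.1, w.2 0, w.2 1])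
  refine (funext fun s => ?_).trans h
  rw [sectorSymbol_eq_sectorSymbolE_toLp, sectorSymbolE_eq_comp hμ₁ hμ₂, toLp_add_smul]
  rfl

/-- **The sector symbol is smooth on `ℝ × ℝ²`** (`0 < e₀ ≤ (4+μ)/2`). [folklore] -/
theorem contDiff_sectorSymbol {e₀ : ℝ} (he : 0 < e₀) (he' : e₀ ≤ (4 + μ) / 2) (n : ℕ) (ω : ℤ) {m : ℕ} :
    ContDiff ℝ m (sectorSymbol e₀ μ n ω) := by
  have hE : sectorSymbol e₀ μ n ω = (sectorSymbolE e₀ μ n ω) ∘ fun p : ℝ × (Fin 2 → ℝ) =>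
      (WithLp.toLp 2 ![p.1, p.2 0, p.2 1] : MomSpace) := funext fun p => sectorSymbol_eq_sectorSymbolE_toLp _ _ _ _ _
  rw [hE, sectorSymbolE_eq_comp hμ₁ hμ₂]
  refine ContDiff.comp ?_ contDiff_toLp_embed
  refine ContDiff.comp ?_ (contDiff_id.add contDiff_const)
  exact ((contDiff_rescaledSectorSymbol hμ₁ hμ₂ he he' n ω).of_le (by exact_mod_cast le_top)).comp
    (ContinuousLinearEquiv.contDiff _)

/-- **`h`-uniform line-derivative bounds of the sector symbol** (Benfatto–Giuliani–Mastropietro 2006, Lemma 2.2,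
pulled back to the original coordinates): for `0 < e₀ ≤ (4+μ)/2` and every `N` there is `B ≥ 0` such that for ALL
scales `n`, all sectors `ω < 2^{n+1}` and all `q, w, s`,
`‖∂ₛᴺ sectorSymbol(q + s w)‖ ≤ 4ⁿ B (4ⁿ|w₀| + 4ⁿ|⟨n(θ_{n,ω}), w⃗⟩| + 2ⁿ|⟨τ(θ_{n,ω}), w⃗⟩|)ᴺ`.
[cite: BenfattoGiulianiMastropietro2006, §2.5 Lemma 2.2 (2.52)] -/
theorem exists_norm_iteratedDeriv_sectorSymbol_line_le {e₀ : ℝ} (he : 0 < e₀) (he' : e₀ ≤ (4 + μ) / 2) (N : ℕ) :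
    ∃ B : ℝ, 0 ≤ B ∧ ∀ (n : ℕ) (ω : ℕ), ω < sectorCount n → ∀ (q w : ℝ × (Fin 2 → ℝ)) (s : ℝ),
      ‖iteratedDeriv N (fun s : ℝ => sectorSymbol e₀ μ n ω (q + s • w)) s‖ ≤
        (4 : ℝ) ^ n * B * ((4 : ℝ) ^ n * |w.1| +
          (4 : ℝ) ^ n * |fermiNormal μ (((ω : ℝ) + 1 / 2) * sectorWidth n) 0 * w.2 0 +
            fermiNormal μ (((ω : ℝ) + 1 / 2) * sectorWidth n) 1 * w.2 1| +
          (2 : ℝ) ^ n * |fermiTangent μ (((ω : ℝ) + 1 / 2) * sectorWidth n) 0 * w.2 0 +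
            fermiTangent μ (((ω : ℝ) + 1 / 2) * sectorWidth n) 1 * w.2 1|) ^ N := by
  obtain ⟨B, hB0, hB⟩ := exists_norm_iteratedFDeriv_rescaledSectorSymbol_le hμ₁ hμ₂ he he' N
  refine ⟨B, hB0, fun n ω hω q w s => ?_⟩
  have hωℤ : ((ω : ℤ) : ℝ) = (ω : ℝ) := by simp
  have hline := sectorSymbol_line_eq hμ₁ hμ₂ e₀ n (ω : ℤ) q w
  rw [hωℤ] at hline
  rw [show (fun s : ℝ => sectorSymbol e₀ μ n (↑ω) (q + s • w)) = fun s : ℝ => sectorSymbol e₀ μ n ((ω : ℤ)) (q + s • w)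
    from rfl, hline]
  have hR : ContDiff ℝ N (rescaledSectorSymbol hμ₁ hμ₂ e₀ n (ω : ℤ)) :=
    (contDiff_rescaledSectorSymbol hμ₁ hμ₂ he he' n (ω : ℤ)).of_le (by exact_mod_cast le_top)
  have hK : ∀ x, ‖iteratedFDeriv ℝ N (rescaledSectorSymbol hμ₁ hμ₂ e₀ n (ω : ℤ)) x‖ ≤ (4 : ℝ) ^ n * B :=
    fun x => hB n ω hω x
  refine (norm_iteratedDeriv_lineRestriction_le_of_le hR hK _ _ s).trans ?_
  refine mul_le_mul_of_nonneg_left (pow_le_pow_left₀ (norm_nonneg _) ?_ N) (by positivity)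
  exact norm_sectorChart_symm_toLp_le hμ₁ hμ₂ _ n w

/-! ### The support in the original coordinates -/

/-- **The support of the sector symbol** in the original coordinates: if `sectorSymbol(k₀, k⃗) ≠ 0` then
`|k₀| ≤ e₀4^{-n}`, the frame coordinates of `k⃗ - p_F(θ_{n,ω})` satisfy `|⟨·, n⟩| ≤ C₁ 4^{-n}`, `|⟨·, τ⟩| ≤ C₂ 2^{-n}`,
and `|k⃗ⱼ| ≤ π/2` (central zone copy). [cite: BenfattoGiulianiMastropietro2006, §2.5 (2.46)–(2.47)] -/
theorem sectorSymbol_support {e₀ : ℝ} (he : 0 < e₀) (he' : e₀ ≤ (4 + μ) / 2) {n : ℕ} {ω : ℤ} {p : ℝ × (Fin 2 → ℝ)}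
    (h : sectorSymbol e₀ μ n ω p ≠ 0) :
    |p.1| ≤ e₀ * (4 : ℝ) ^ (-(n : ℤ)) ∧
      |(p.2 0 - fermiX μ (((ω : ℝ) + 1 / 2) * sectorWidth n)) * fermiNormal μ (((ω : ℝ) + 1 / 2) * sectorWidth n) 0 +
          (p.2 1 - fermiY μ (((ω : ℝ) + 1 / 2) * sectorWidth n)) * fermiNormal μ (((ω : ℝ) + 1 / 2) * sectorWidth n) 1| ≤
        normalExtentConst μ e₀ * (4 : ℝ) ^ (-(n : ℤ)) ∧
      |(p.2 0 - fermiX μ (((ω : ℝ) + 1 / 2) * sectorWidth n)) * fermiTangent μ (((ω : ℝ) + 1 / 2) * sectorWidth n) 0 +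
          (p.2 1 - fermiY μ (((ω : ℝ) + 1 / 2) * sectorWidth n)) * fermiTangent μ (((ω : ℝ) + 1 / 2) * sectorWidth n) 1| ≤
        tangentExtentConst μ e₀ * (2 : ℝ) ^ (-(n : ℤ)) ∧
      ∀ j, |p.2 j| ≤ π / 2 := by
  obtain ⟨h0, hbox⟩ := sectorSymbol_ne_zero hμ₁ hμ₂ he he' h
  have hk0 : |p.1| ≤ e₀ * (4 : ℝ) ^ (-(n : ℤ)) := abs_le.2 ⟨by linarith [h0.1], h0.2⟩
  obtain ⟨hnorm, htan⟩ := hbox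
  refine ⟨hk0, ?_, ?_, fun j => ?_⟩
  · rw [← normalExtent_eq]; exact hnorm
  · exact htan.trans (tangentExtent_le hμ₁ he.le n)
  · -- the zone bump restricts to `|k⃗| ≤ π/2`
    have hnum : anisotropicCutoff e₀ μ n ω p * zoneBump p.2 ≠ 0 := by
      intro h0'
      apply h
      rw [sectorSymbol, h0', Complex.ofReal_zero, zero_div]
    have hχ : zoneBump p.2 ≠ 0 := right_ne_zero_of_mul hnum
    have hk := norm_le_of_zoneBump_ne_zero hχ
    have hsq := norm_momToComplex_sq p.2
    have hj : (p.2 j) ^ 2 ≤ ‖momToComplex p.2‖ ^ 2 := by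
      rw [hsq]; fin_cases j
      · simpa using sq_nonneg (p.2 1)
      · simpa using sq_nonneg (p.2 0)
    have habs : |p.2 j| ≤ ‖momToComplex p.2‖ := abs_le_of_sq_le_sq' hj (norm_nonneg _) |>.2 |> fun h2 =>
      abs_le.2 ⟨(abs_le_of_sq_le_sq' hj (norm_nonneg _)).1, h2⟩
    exact habs.trans hk

end Lines

end Literature.MathematicalPhysics.QuantumLattice
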